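import Literature.IUT.LogThetaLattice.PacketLogVolumes
import HarnessLib

/-!
# [IUTchIII] Remark 3.9.7 (ii), (iii): the extended log-volume of relatively compact subsets / collections is
# an EXTENSION of the log-volume — consistency and elementary properties (proof-only companion)

S. Mochizuki, *Inter-universal Teichmüller theory III*, kurims manuscript (May 2020), Remark 3.9.7, pp. 146–147
[claim: Mochizuki2012, status: disputed]: (ii) "one may consider the log-volume of more general, say,
relatively compact subsets `E ⊆ 𝓘^ℚ((−))` … simply by defining the log-volume of `E` to be the infimum of the
log-volumes of the sets `E* ∈ 𝕄(𝓘^ℚ((−)))` such that `E ⊆ E*`. This definition means that one must allow for the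
possibility that the log-volume of `E` is `−∞`"; (iii) the same for collections `{E_{v_ℚ}}_{v_ℚ}` dominated by a
global region, "the infimum of the log-volumes of the collections … `{E*_{v_ℚ}}` … such that `E_{v_ℚ} ⊆ E*_{v_ℚ}`".
abc-iut-L6-t4 typed both as REAL `EReal`-valued definitions (`logVolumeOfRelCompact M μlog E`,
`globalLogVolumeOfCollection μlog incl E`, `PacketLogVolumes.lean` p404053) and proved monotonicity of the first.

THIS FILE records the sanity clauses the printed "simply by defining" presupposes (plan/L6/SUBDAG-IUTchIII-Prop-39.md,
Remarks census; seat abc-iut-w5-d178):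
* `logVolumeOfRelCompact_le_of_mem` — for `E* ∈ 𝕄` with `E ⊆ E*`, the extended log-volume of `E` is `≤ μ^log(E*)`;
* **`logVolumeOfRelCompact_eq_of_mem`** — the extension AGREES with `μ^log` on `𝕄` itself whenever `μ^log` is
  monotone on `𝕄` (the infimum over `E* ⊇ E`, `E* ∈ 𝕄`, is attained at `E* = E`): it is an extension, not a
  redefinition;
* `logVolumeOfRelCompact_eq_top_iff` — the value is `+∞` exactly when NO `E* ∈ 𝕄` contains `E` (so for relatively
  compact `E` inside some compact open region the value is `< +∞`); the printed "possibility … `−∞`" is the value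
  `⊥` of `EReal`, attained e.g. when `μ^log` is unbounded below on the covers;
* `globalLogVolumeOfCollection_le_of_dominating` / `…_mono` — the collection version is bounded by the global
  log-volume of any dominating global region and is monotone in the collection.
Elementary order theory (`sInf` on `EReal`); no new definitions; nothing here bears on [IUTchIII] Cor. 3.12.
-/

namespace Literature.IUT.LogThetaLattice

universe u v

/-! ### Remark 3.9.7 (ii) -/

section RelCompact

variable {X : Type u} (M : Set (Set X)) (μlog : Set X → ℝ)

/-- Any admissible cover bounds the extended log-volume: `E ⊆ E* ∈ 𝕄 ⇒ μ^log_ext(E) ≤ μ^log(E*)`.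
[claim: Mochizuki2012, status: disputed] -/
theorem logVolumeOfRelCompact_le_of_mem {E Estar : Set X} (hM : Estar ∈ M) (hE : E ⊆ Estar) :
    logVolumeOfRelCompact M μlog E ≤ ((μlog Estar : ℝ) : EReal) :=
  sInf_le ⟨Estar, ⟨hM, hE⟩, rfl⟩

/-- **Consistency of Remark 3.9.7 (ii)**: on a region `E ∈ 𝕄` the extended log-volume IS `μ^log(E)`, provided
`μ^log` is monotone on `𝕄` (as every log-volume of a measure is): the definition "infimum of the log-volumes of
the sets `E* ∈ 𝕄` such that `E ⊆ E*`" extends, and does not alter, the log-volume of Proposition 3.9.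
[claim: Mochizuki2012, status: disputed] -/
theorem logVolumeOfRelCompact_eq_of_mem (hmono : ∀ A ∈ M, ∀ B ∈ M, A ⊆ B → μlog A ≤ μlog B)
    {E : Set X} (hE : E ∈ M) :
    logVolumeOfRelCompact M μlog E = ((μlog E : ℝ) : EReal) := by
  refine le_antisymm (logVolumeOfRelCompact_le_of_mem M μlog hE le_rfl) ?_
  refine le_sInf ?_
  rintro _ ⟨Estar, ⟨hM, hsub⟩, rfl⟩
  exact EReal.coe_le_coe_iff.mpr (hmono E hE Estar hM hsub)

/-- The extended log-volume is `+∞` exactly when no region of `𝕄` contains `E` (empty infimum); in particular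
it is `< +∞` for every `E` contained in some `E* ∈ 𝕄` — e.g. relatively compact `E` in a space exhausted by
compact open regions. [claim: Mochizuki2012, status: disputed] -/
theorem logVolumeOfRelCompact_eq_top_iff (E : Set X) :
    logVolumeOfRelCompact M μlog E = ⊤ ↔ ∀ Estar ∈ M, ¬ E ⊆ Estar := by
  constructor
  · intro h Estar hM hsub
    have hle := logVolumeOfRelCompact_le_of_mem M μlog hM hsub
    rw [h, top_le_iff] at hle
    exact EReal.coe_ne_top _ hle
  · intro h
    unfold logVolumeOfRelCompact
    have hempty : ((fun Estar => ((μlog Estar : ℝ) : EReal)) '' {Estar | Estar ∈ M ∧ E ⊆ Estar}) = ∅ := by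
      rw [Set.image_eq_empty]
      ext Estar
      simp only [Set.mem_setOf_eq, Set.mem_empty_iff_false, iff_false, not_and]
      exact fun hM hsub => h Estar hM hsub
    rw [hempty, sInf_empty]

/-- The extended log-volume of a region contained in an admissible one is a real number or `−∞`, never `+∞`.
[claim: Mochizuki2012, status: disputed] -/
theorem logVolumeOfRelCompact_lt_top_of_subset {E Estar : Set X} (hM : Estar ∈ M) (hE : E ⊆ Estar) :
    logVolumeOfRelCompact M μlog E < ⊤ :=
  lt_of_le_of_lt (logVolumeOfRelCompact_le_of_mem M μlog hM hE) (EReal.coe_lt_top _)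

end RelCompact

/-! ### Remark 3.9.7 (iii) -/

section Collections

variable {VQ : Type u} {Region : VQ → Type v} {X : VQ → Type v}
variable (μlog : ∀ vQ, Region vQ → ℝ) (incl : ∀ vQ, Region vQ → Set (X vQ))

/-- Any dominating global region bounds the extended log-volume of a collection:
`(∀ v_ℚ, E_{v_ℚ} ⊆ S_{v_ℚ}) ⇒ μ^log_ext({E_{v_ℚ}}) ≤ μ^log_{A,𝕍_ℚ}(S)`. [claim: Mochizuki2012, status: disputed] -/
theorem globalLogVolumeOfCollection_le_of_dominating (E : ∀ vQ, Set (X vQ)) (S : GlobalRegion μlog)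
    (hS : ∀ vQ, E vQ ⊆ incl vQ (S.1 vQ)) :
    globalLogVolumeOfCollection μlog incl E ≤ ((globalLogVolume μlog S : ℝ) : EReal) :=
  sInf_le ⟨S, hS, rfl⟩

/-- Monotonicity of Remark 3.9.7 (iii) in the collection: `E ⊆ E'` componentwise ⇒ `μ^log_ext(E) ≤ μ^log_ext(E')`
(every global region dominating `E'` dominates `E`). [claim: Mochizuki2012, status: disputed] -/
theorem globalLogVolumeOfCollection_mono {E E' : ∀ vQ, Set (X vQ)} (h : ∀ vQ, E vQ ⊆ E' vQ) :
    globalLogVolumeOfCollection μlog incl E ≤ globalLogVolumeOfCollection μlog incl E' := by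
  apply sInf_le_sInf
  rintro _ ⟨S, hS, rfl⟩
  exact ⟨S, fun vQ => (h vQ).trans (hS vQ), rfl⟩

/-- **Consistency of Remark 3.9.7 (iii)**: for the collection underlying a global region `S` itself, the extended
log-volume IS `μ^log_{A,𝕍_ℚ}(S)` whenever the global log-volume is monotone with respect to componentwise inclusion
of the underlying subsets (as sums of monotone local log-volumes are). [claim: Mochizuki2012, status: disputed] -/
theorem globalLogVolumeOfCollection_eq_of_globalRegion
    (hmono : ∀ S T : GlobalRegion μlog, (∀ vQ, incl vQ (S.1 vQ) ⊆ incl vQ (T.1 vQ)) →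
      globalLogVolume μlog S ≤ globalLogVolume μlog T)
    (S : GlobalRegion μlog) :
    globalLogVolumeOfCollection μlog incl (fun vQ => incl vQ (S.1 vQ)) =
      ((globalLogVolume μlog S : ℝ) : EReal) := by
  refine le_antisymm (globalLogVolumeOfCollection_le_of_dominating μlog incl _ S fun vQ => le_rfl) ?_
  refine le_sInf ?_
  rintro _ ⟨T, hT, rfl⟩
  exact EReal.coe_le_coe_iff.mpr (hmono S T hT)

end Collections

end Literature.IUT.LogThetaLattice
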